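import Summits.BirchSwinnertonDyer.BirchSwinnertonDyer.Theorems.KatoDescentTamePotSupersingularTameUpperUnitTwistRecordToolsConductor
import HarnessLib

/-!
# Route `KatoDescentTamePotSupersingular` (rung K8, sub-rung B4 (t′), cell `bsd-potss`): conductor TOOL, supplement —
# `f_p = 2` at an additive `p ≥ 5` with `ord_p Δ ≥ 12` (potentially multiplicative `Iₙ*`, `n ≥ 6`), minimality from `p⁴ ∤ c₄`
# (seat `bsd-potss-k8t-c4` g15; route-free; 0 definitions, 0 named facts, 0 `sorry`; closes nothing)

WHY. `…RecordToolsConductor.conductorExponent_natPlace_eq_two_of_five_le` reads minimality at `p` off `ord_p Δ(E₀) < 12`; a minimal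
model of type `Iₙ*` with `n ≥ 6` at `p ≥ 5` has `ord_p Δ = n + 6 ≥ 12` and `ord_p c₄ = 2`, so Silverman's OTHER criterion
`p⁴ ∤ c₄(E₀)` (AEC VII.1 Rem. 1.1) is the one that applies (3 of k9-c4's K9 record rows: 163350fw1, 163350fz1, 228150s1 at `p = 5`).
Same observatory lemma `hasAdditiveReductionAt_of_dvd`, other disjunct.

References: [SilvermanAEC2009] VII.1 Rem. 1.1, VII.5.1; [SilvermanATAEC1994] IV.10.2(b), IV.10.4.
-/

set_option autoImplicit false
-- the Theorems directory repeats the summit name (sibling precedent `KatoDescentPotSupersingularAssembly.lean`)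
set_option linter.dupNamespace false

noncomputable section

open scoped Classical

namespace Summit.BirchSwinnertonDyer.BirchSwinnertonDyer.Theorems.TameUpperUnitTwistRecords

open WeierstrassCurve IsDedekindDomain Rat.HeightOneSpectrum
  Literature.NumberTheory.EllipticCurves Literature.NumberTheory.EllipticCurves.Rank1Residual
  Summit.BirchSwinnertonDyer.BirchSwinnertonDyer.Rank1Residual.IntModel
  Summit.BirchSwinnertonDyer.BirchSwinnertonDyer.Rank2Observatory.RootNumber

/-- **`f_p = 2` at an additive prime `p ≥ 5`, minimality by `p⁴ ∤ c₄`**: for the globally minimal `W` with integer model `E₀`, a prime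
`p ≥ 5` with `pⁿ ∥ Δ(E₀)` (`n ≥ 1`), `p ∣ c₄(E₀)` and `p⁴ ∤ c₄(E₀)`, the conductor exponent is `2` (Silverman *ATAEC* IV.10.2(b),
IV.10.4; minimality at `p` by *AEC* VII.1 Rem. 1.1, second criterion; `conductorExponent_eq_two_of_five_le_of_isElliptic` with the
observatory's `hasAdditiveReductionAt_of_dvd`). [cite: SilvermanATAEC1994, Thm. IV.10.2(b) and IV.10.4] [cite: SilvermanAEC2009, VII.1 Remark 1.1] -/
theorem conductorExponent_natPlace_eq_two_of_five_le_of_not_pow_four_dvd_c₄ {W : WeierstrassCurve ℚ} [W.IsElliptic]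
    [W.IsGloballyMinimal] {E₀ : WeierstrassCurve ℤ} (hI : integralModelInt W = E₀) {p : ℕ} (hp : p.Prime) (h5 : 5 ≤ p)
    {n : ℕ} (hn : 1 ≤ n) (hΔ : (p : ℤ) ^ n ∣ E₀.Δ) (hΔ' : ¬ (p : ℤ) ^ (n + 1) ∣ E₀.Δ)
    (hc₄4 : ¬ (p : ℤ) ^ 4 ∣ E₀.c₄) (hc₄ : (p : ℤ) ∣ E₀.c₄) :
    W.conductorExponent (natPlace p) = 2 := by
  have hW : W = E₀.baseChange ℚ := by
    rw [← hI, WeierstrassCurve.baseChange, algebraMap_int_eq, map_integralModelInt]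
  subst hW
  refine conductorExponent_eq_two_of_five_le_of_isElliptic (E₀.baseChange ℚ) (natPlace p)
    (by rwa [natGenerator_natPlace hp]) ?_
  exact hasAdditiveReductionAt_of_dvd (natPlace p) hn (by rwa [natGenerator_natPlace hp])
    (by rwa [natGenerator_natPlace hp]) (Or.inr (by rwa [natGenerator_natPlace hp])) (by rwa [natGenerator_natPlace hp])

end Summit.BirchSwinnertonDyer.BirchSwinnertonDyer.Theorems.TameUpperUnitTwistRecords
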